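import Summits.ResolutionOfSingularities.ResolutionOfSingularities.Theorems.MarkedTransferCampaignW46CuspStaircasePropagation
import HarnessLib

/-!
# [OURS · L1 W4.6, rung (iii)] The cusp staircase, X — RÉSUMÉ-FREE one-step laws: a §2.1-permissible blow-up of a
# window / staircase state (cell res-hironaka, LADDER-RESOLUTION rung L, D-0089; slot W4.6, seat res-L1-s46-pv-5 gen 3;
# host route MarkedTransfer, `--kind proof --supports stmt-ResolutionOfSingularities-16155 --as helper`)

HONEST FRAMING. Everything below is OURS: kernel theorems about the campaign definitions `CampaignW46.Regime.mohWindowCurve`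
(p472581) and `CampaignW46.Regime.cuspCurve` (p482083) and the tree's REAL blow-up library
(`Literature.AlgebraicGeometry.Resolution.*`: `IsBlowup`, `controlledTransform`, `idealOrder`). NOTHING here is a
statement of H. Hironaka's manuscript *Resolution of singularities in positive characteristics* (2017-03-23,
[Hironaka2017]) and nothing here asserts that any statement of it holds; the manuscript enters only through the typed
CANDIDATE carriers of row 001 (`IdealExponent`, `sing`, `transform`). No FACT-LIST premise is used. AI review is weaker
than expert review. No `sorry`; axioms standard.

## Why this file (the GEOMETRIC form of rung (iii) on curves)

The one-step laws of this seat's files `…MohWindowProof.lean` (p473117), `…CuspStaircaseDescent.lean` (p483211),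
`…CuspStaircaseExitBound.lean` (p486759), `…CuspStaircasePropagation.lean` (p500291) are stated for a step `s : Step R A′`
of the TYPED Th. 16.6 procedure — a blow-up whose centre is admitted by the typed centre rule at a RÉSUMÉ `R` of `E`
(whose existence the rungs posit). Their proofs use of `s` only: `π` is the blowing up along the reduced ideal of `D`,
`D` is irreducible and `D ⊆ Sing(E)`. This file re-states them in exactly that generality — for ANY §2.1-permissible
point blow-up, no résumé, no notion instance — so that the companion `…CuspStaircasePermissibleRun.lean` can prove the
résumé-free rung: EVERY §2.1-permissible blow-up sequence (seat pv-1's `PermissibleRun` / `FinPermissibleRun`,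
`…PermissibleReduction.lean` / `…FiniteExitBound.lean`) starting at a window / staircase state is finite, of length at
most `#Sing(E₀)` / `Σ(E₀)/b`.

## What is proved (namespace `…Theorems.CampaignW46.Cusp`; data: ambient data `A`, `A′` over `K`, `E` on `A.Z`, a closed
## `D ⊆ A.Z`, `π : A′.Z ⟶ A.Z` with `IsBlowup π 𝓘_D`; `E′ := E.transform π D` written out)

* `exists_eq_singleton_of_subset_sing` — in either regime an irreducible closed `D ⊆ Sing(E)` is a closed point `{ξ}`.
* `transform_cuspAt_and_cuspIndexAt_le_of_over` — over `ξ`: every `x′ ∈ Sing(E′)` is a cusp point with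
  `index(x′) + b ≤ index(ξ)`; `transform_mem_sing_and_cuspIndexAt_eq_of_ne`, `transform_germ_of_ne`,
  `transform_isClosed_singleton_of_ne` — off `ξ`: `π x′ ∈ Sing(E)`, same index, same germ up to `π^♯`, `x′` closed.
* `transform_sing_over_subsingleton`, `transform_sing_finite_and_ncard_le`, `transform_sum_cuspMultiset_add_le` —
  at most one singular point over `ξ`; `Sing(E′)` finite with `#Sing(E′) ≤ #Sing(E)`; `Σ(E′) + b ≤ Σ(E)`.
* `transform_cuspCurve` — the staircase regime is stable under the permissible point blow-up (closedness over `ξ` by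
  `Cusp.isClosed_singleton_of_le`, file VIII p499319). The window twins (`#Sing(E′) < #Sing(E)`,
  `transform_mohWindowCurve`) and the run-level consequences are in file XI `…CuspStaircasePermissibleRun.lean`.

## References

* This seat's files cited above; seat pv-1: `…PermissibleReduction.lean`, `…FiniteExitBound.lean` (p485314/p488284);
  RUNG-MAP-W46.md §RUNG (iii)/(i-a)′ (res-L1-type-o1).
* The Stacks Project, Tags 0804, 02OS, 01TB. [cite: StacksProject, Tag 0804]
* H. Hironaka, ms. 2017-03-23, §2.1 p.4 l.35–39, Def. 2.1 p.5 l.2–3, Th. 16.13 p.87 l.26–28 — scope only, under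
  adjudication, not cited as fact. [Hironaka2017]
-/

noncomputable section

set_option linter.dupNamespace false -- mandated namespace of this single-conjunct summit

open CategoryTheory AlgebraicGeometry TopologicalSpace IsLocalRing

namespace Summit.ResolutionOfSingularities.ResolutionOfSingularities.Theorems

namespace CampaignW46

open Literature.AlgebraicGeometry.Resolution
open Literature.AlgebraicGeometry.Hironaka2017.S02Preliminaries
open Literature.AlgebraicGeometry.Hironaka2017.Datum
open Scheme.IdealSheafData

universe u

namespace Cusp

section PermissibleStep

variable {p : ℕ} [Fact p.Prime] {K : Type u} [Field K] [CharP K p]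
variable {A A' : AmbientDatum p K} {E : IdealExponent A.Z} {D : Closeds A.Z} {π : A'.Z ⟶ A.Z}

/-! ## The centre -/

/-- **In either curve regime a permissible centre is a closed singular point.** If `Sing(E)` consists of closed points
and `D ⊆ Sing(E)` is closed irreducible, then `D = {ξ}` for a closed point `ξ ∈ Sing(E)` (the generic point of `D`).
[folklore] -/
theorem exists_eq_singleton_of_subset_sing
    (hcl : E.sing ⊆ Literature.AlgebraicGeometry.Hironaka2017.S02Preliminaries.closedPoints A.Z)
    (hDirr : IsIrreducible (D : Set A.Z)) (hDS : (D : Set A.Z) ⊆ E.sing) :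
    ∃ ξ : A.Z, ξ ∈ E.sing ∧ IsClosed ({ξ} : Set A.Z) ∧ (D : Set A.Z) = {ξ} := by
  have hgen : IsGenericPoint hDirr.genericPoint (D : Set A.Z) :=
    hDirr.isGenericPoint_genericPoint D.isClosed
  have hηS : hDirr.genericPoint ∈ E.sing := hDS hgen.mem
  have hηcl : IsClosed ({hDirr.genericPoint} : Set A.Z) := hcl hηS
  exact ⟨hDirr.genericPoint, hηS, hηcl, hgen.def.symm.trans hηcl.closure_eq⟩

/-! ## Over the centre -/

/-- **The staircase step over the centre, résumé-free.** For a staircase state `(A, E)`, the blow-up `π` of the closed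
point `ξ` (`D = {ξ} ⊆ Sing(E)`), and `x′ ∈ Sing(E′)` over `ξ` (`E′ = E.transform π D`): `x′` is a cusp point of exponent
`b` and `index(x′) + b ≤ index(ξ)` (`Cusp.cuspShape_transform_of_le` at the least presentation). [folklore] -/
theorem transform_cuspAt_and_cuspIndexAt_le_of_over (hπ : IsBlowup π (vanishingIdeal D))
    (hRg : Regime.cuspCurve A E) {ξ : A.Z} (hξS : ξ ∈ E.sing) (hDξ : (D : Set A.Z) = {ξ}) {x' : A'.Z}
    (hx' : x' ∈ (E.transform π D).sing) (hπx : π.base x' = ξ) :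
    CuspAt E.b (A'.Z.presheaf.stalk x') (stalkIdeal (E.transform π D).J x') ∧
      cuspIndexAt (E.transform π D) x' + E.b ≤ cuspIndexAt E ξ := by
  subst hπx
  obtain ⟨hb, -, hcl, hcusp⟩ := hRg
  haveI : IsLocallyNoetherian A'.Z := by
    haveI := A'.smooth
    exact LocallyOfFiniteType.isLocallyNoetherian A'.hom
  have hξcl : IsClosed ({π.base x'} : Set A.Z) := hcl hξS
  have hY : stalkIdeal (vanishingIdeal D) (π.base x') = maximalIdeal (A.Z.presheaf.stalk (π.base x')) := by
    apply stalkIdeal_vanishingIdeal_eq_maximalIdeal_of_closure_eq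
    rw [hDξ, hξcl.closure_eq]
  obtain ⟨hnd, hshape⟩ := Cusp.cuspIndex_spec (hcusp _ hξS)
  have hleξ : stalkIdeal E.J (π.base x') ≤ maximalIdeal _ ^ E.b := (le_idealOrder_iff _ _ _).mp hξS
  have hbd : E.b < cuspIndexAt E (π.base x') := Cusp.lt_of_cuspShape_of_le_pow hshape hnd hleξ
  have hx'b : (E.b : ℕ∞) ≤ idealOrder (controlledTransform π (vanishingIdeal D) E.J E.b) x' := hx'
  have hshape' := Cusp.cuspShape_transform_of_le hπ hb hbd hY hshape hx'b
  have hnd' : ¬ E.b ∣ (cuspIndexAt E (π.base x') - E.b) := fun h => hnd (by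
    have h2 := dvd_add h (dvd_refl E.b)
    rwa [Nat.sub_add_cancel hbd.le] at h2)
  refine ⟨⟨_, hnd', hshape'⟩, ?_⟩
  have hle : cuspIndexAt (E.transform π D) x' ≤ cuspIndexAt E (π.base x') - E.b := Cusp.cuspIndex_le hnd' hshape'
  omega

/-- **The singular point over a blown-up closed cusp point is closed, résumé-free** (`Cusp.isClosed_singleton_of_le`
at the least presentation; `π` is locally of finite type by `A′.hom = π ≫ A.hom`). [cite: StacksProject, Tag 01TB] -/
theorem transform_isClosed_singleton_of_over (hπ : IsBlowup π (vanishingIdeal D)) (hhom : A'.hom = π ≫ A.hom)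
    (hRg : Regime.cuspCurve A E) {ξ : A.Z} (hξS : ξ ∈ E.sing) (hDξ : (D : Set A.Z) = {ξ}) {x' : A'.Z}
    (hx' : x' ∈ (E.transform π D).sing) (hπx : π.base x' = ξ) : IsClosed ({x'} : Set A'.Z) := by
  subst hπx
  obtain ⟨hb, -, hcl, hcusp⟩ := hRg
  haveI := A.smooth
  haveI := A'.smooth
  haveI : IsLocallyNoetherian A'.Z := LocallyOfFiniteType.isLocallyNoetherian A'.hom
  haveI : JacobsonSpace A.Z := LocallyOfFiniteType.jacobsonSpace A.hom
  haveI : LocallyOfFiniteType π := by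
    have h : LocallyOfFiniteType (π ≫ A.hom) := by
      rw [← hhom]
      infer_instance
    exact locallyOfFiniteType_of_comp π A.hom
  have hξcl : IsClosed ({π.base x'} : Set A.Z) := hcl hξS
  have hY : stalkIdeal (vanishingIdeal D) (π.base x') = maximalIdeal (A.Z.presheaf.stalk (π.base x')) := by
    apply stalkIdeal_vanishingIdeal_eq_maximalIdeal_of_closure_eq
    rw [hDξ, hξcl.closure_eq]
  obtain ⟨hnd, hshape⟩ := Cusp.cuspIndex_spec (hcusp _ hξS)
  have hbd : E.b < cuspIndexAt E (π.base x') :=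
    Cusp.lt_of_cuspShape_of_le_pow hshape hnd (stalkIdeal_le_pow_of_mem_sing hξS)
  have hx'b : (E.b : ℕ∞) ≤ idealOrder (controlledTransform π (vanishingIdeal D) E.J E.b) x' := hx'
  exact Cusp.isClosed_singleton_of_le hπ hb hbd hξcl hY hshape hx'b

/-- **At most one singular point over the centre, résumé-free** (`Cusp.eq_of_le_of_le` at the least presentation of
`J_ξ`). [folklore] -/
theorem transform_sing_over_subsingleton (hπ : IsBlowup π (vanishingIdeal D)) (hRg : Regime.cuspCurve A E)
    {ξ : A.Z} (hξS : ξ ∈ E.sing) (hDξ : (D : Set A.Z) = {ξ}) :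
    {x' ∈ (E.transform π D).sing | π.base x' = ξ}.Subsingleton := by
  classical
  intro x₁ h₁ x₂ h₂
  obtain ⟨h₁S, h₁⟩ := h₁
  obtain ⟨h₂S, h₂⟩ := h₂
  obtain ⟨hb, -, hcl, hcusp⟩ := hRg
  haveI : IsLocallyNoetherian A'.Z := by
    haveI := A'.smooth
    exact LocallyOfFiniteType.isLocallyNoetherian A'.hom
  have hξcl : IsClosed ({ξ} : Set A.Z) := hcl hξS
  have hY : stalkIdeal (vanishingIdeal D) ξ = maximalIdeal (A.Z.presheaf.stalk ξ) := by
    apply stalkIdeal_vanishingIdeal_eq_maximalIdeal_of_closure_eq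
    rw [hDξ, hξcl.closure_eq]
  obtain ⟨hnd, hreg, hdim, x, y, hxy, u, hu, hJ⟩ := Cusp.cuspIndex_spec (hcusp ξ hξS)
  haveI := hreg
  have hbd : E.b < cuspIndexAt E ξ :=
    Cusp.lt_of_cuspShape_of_le_pow ⟨hreg, hdim, x, y, hxy, u, hu, hJ⟩ hnd (stalkIdeal_le_pow_of_mem_sing hξS)
  obtain ⟨c, hc_def⟩ : ∃ c : Fin 2 → A.Z.presheaf.stalk ξ, c = ![x, y] := ⟨_, rfl⟩
  have hc0 : c 0 = x := by rw [hc_def]; rfl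
  have hc1 : c 1 = y := by rw [hc_def]; rfl
  have hc : Ideal.span (Set.range c) = maximalIdeal _ := by rw [hc_def, MohWindow.range_vec2]; exact hxy
  have hJc : stalkIdeal E.J ξ = Ideal.span {c 1 ^ E.b + u * c 0 ^ cuspIndexAt E ξ} := by
    rw [hJ, hc0, hc1]; rfl
  exact Cusp.eq_of_le_of_le hπ hb hbd hdim c hc hY hu hJc h₁ h₂ h₁S h₂S

/-! ## Off the centre -/

/-- **Off the centre nothing changes, résumé-free**: for `x′ ∈ Sing(E′)` not over `ξ`, `π x′ ∈ Sing(E)` and the cusp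
indices agree. [cite: StacksProject, Tag 02OS] -/
theorem transform_mem_sing_and_cuspIndexAt_eq_of_ne (hπ : IsBlowup π (vanishingIdeal D)) {ξ : A.Z}
    (hDξ : (D : Set A.Z) = {ξ}) {x' : A'.Z} (hx' : x' ∈ (E.transform π D).sing) (hπx : π.base x' ≠ ξ) :
    π.base x' ∈ E.sing ∧ cuspIndexAt (E.transform π D) x' = cuspIndexAt E (π.base x') := by
  haveI : IsLocallyNoetherian A'.Z := by
    haveI := A'.smooth
    exact LocallyOfFiniteType.isLocallyNoetherian A'.hom
  have hnot : π.base x' ∉ (vanishingIdeal D).support := by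
    rw [← SetLike.mem_coe, coe_support_vanishingIdeal, hDξ]
    exact hπx
  refine ⟨?_, Cusp.cuspIndex_transform_of_not_mem_support hπ E.J E.b hnot⟩
  show (E.b : ℕ∞) ≤ idealOrder E.J (π.base x')
  rw [← hπ.idealOrder_controlledTransform_eq_of_not_mem_support E.J E.b hnot]
  exact hx'

/-- **Off the centre the germ is carried by `π^♯`, résumé-free**: `CuspAt` and `MohWindowAt` pass from `π x′` to `x′`
(`stalkIdeal_controlledTransform_of_not_mem_support` + transport along the ring isomorphism `π^♯_{x′}`).
[cite: StacksProject, Tag 02OS] -/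
theorem transform_germ_of_ne (hπ : IsBlowup π (vanishingIdeal D)) {ξ : A.Z} (hDξ : (D : Set A.Z) = {ξ})
    {x' : A'.Z} (hπx : π.base x' ≠ ξ) :
    (CuspAt E.b (A.Z.presheaf.stalk (π.base x')) (stalkIdeal E.J (π.base x')) →
        CuspAt E.b (A'.Z.presheaf.stalk x') (stalkIdeal (E.transform π D).J x')) ∧
      (MohWindowAt E.b (A.Z.presheaf.stalk (π.base x')) (stalkIdeal E.J (π.base x')) →
        MohWindowAt E.b (A'.Z.presheaf.stalk x') (stalkIdeal (E.transform π D).J x')) := by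
  haveI : IsLocallyNoetherian A'.Z := by
    haveI := A'.smooth
    exact LocallyOfFiniteType.isLocallyNoetherian A'.hom
  have hnot : π.base x' ∉ (vanishingIdeal D).support := by
    rw [← SetLike.mem_coe, coe_support_vanishingIdeal, hDξ]
    exact hπx
  haveI := hπ.isIso_stalkMap_of_not_mem_support hnot
  let ε : A.Z.presheaf.stalk (π.base x') ≃+* A'.Z.presheaf.stalk x' :=
    (asIso (π.stalkMap x')).commRingCatIsoToRingEquiv
  have hε : (ε : A.Z.presheaf.stalk (π.base x') →+* A'.Z.presheaf.stalk x') = (π.stalkMap x').hom := rfl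
  have hJ' : stalkIdeal (E.transform π D).J x' = (stalkIdeal E.J (π.base x')).map (ε : _ →+* _) := by
    rw [hε]
    exact stalkIdeal_controlledTransform_of_not_mem_support E.J E.b hnot
  refine ⟨fun h => ?_, fun h => ?_⟩
  · rw [hJ']
    exact Cusp.cuspAt_map_of_ringEquiv ε h
  · rw [hJ']
    exact Cusp.mohWindowAt_map_of_ringEquiv ε h

/-- **Off the centre, points over closed points are closed, résumé-free** (`{x′} = π⁻¹{π x′}`, the blow-up being injective
off `π⁻¹(D)`). [cite: StacksProject, Tag 02OS] -/
theorem transform_isClosed_singleton_of_ne (hπ : IsBlowup π (vanishingIdeal D)) {ξ : A.Z}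
    (hDξ : (D : Set A.Z) = {ξ}) {x' : A'.Z} (hπx : π.base x' ≠ ξ) (hcl : IsClosed ({π.base x'} : Set A.Z)) :
    IsClosed ({x'} : Set A'.Z) := by
  have hx : π.base x' ∉ (D : Set A.Z) := by
    rw [hDξ]
    exact hπx
  have heq : ({x'} : Set A'.Z) = π.base ⁻¹' {π.base x'} := by
    ext z
    simp only [Set.mem_singleton_iff, Set.mem_preimage]
    constructor
    · rintro rfl
      rfl
    · intro hz
      refine MohWindow.injOn_preimage_compl hπ ?_ hx hz
      show π.base z ∈ (D : Set A.Z)ᶜ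
      rw [hz]
      exact hx
  rw [heq]
  exact hcl.preimage π.continuous

/-! ## Counting the singular points and the total index -/

/-- **`#Sing` never increases, résumé-free**: for a staircase state and the permissible blow-up of an irreducible closed
`D ⊆ Sing(E)`, `Sing(E′)` is finite and `#Sing(E′) ≤ #Sing(E)`. [folklore] -/
theorem transform_sing_finite_and_ncard_le (hπ : IsBlowup π (vanishingIdeal D)) (hRg : Regime.cuspCurve A E)
    (hDirr : IsIrreducible (D : Set A.Z)) (hDS : (D : Set A.Z) ⊆ E.sing) :
    (E.transform π D).sing.Finite ∧ (E.transform π D).sing.ncard ≤ E.sing.ncard := by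
  classical
  obtain ⟨ξ, hξS, hξcl, hDξ⟩ := exists_eq_singleton_of_subset_sing hRg.2.2.1 hDirr hDS
  have hfin : E.sing.Finite := hRg.2.1
  obtain ⟨off, hoff_def⟩ : ∃ off : Set A'.Z, off = {x' ∈ (E.transform π D).sing | π.base x' ≠ ξ} := ⟨_, rfl⟩
  obtain ⟨fib, hfib_def⟩ : ∃ fib : Set A'.Z, fib = {x' ∈ (E.transform π D).sing | π.base x' = ξ} := ⟨_, rfl⟩
  have hunion : (E.transform π D).sing = off ∪ fib := by
    ext x'
    rw [hoff_def, hfib_def]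
    simp only [Set.mem_union, Set.mem_setOf_eq]
    tauto
  have hoff_maps : Set.MapsTo π.base off (E.sing \ {ξ}) := fun x' hx' => by
    rw [hoff_def] at hx'
    exact ⟨(transform_mem_sing_and_cuspIndexAt_eq_of_ne hπ hDξ hx'.1 hx'.2).1, hx'.2⟩
  have hoff_inj : Set.InjOn π.base off := by
    refine (MohWindow.injOn_preimage_compl hπ).mono fun x' hx' => ?_
    show π.base x' ∈ (D : Set A.Z)ᶜ
    rw [hDξ]
    rw [hoff_def] at hx'
    exact hx'.2
  have hoff_fin : off.Finite :=
    Set.Finite.of_finite_image ((hfin.subset fun _ hx => hx.1).subset hoff_maps.image_subset) hoff_inj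
  have hfib_sub : fib.Subsingleton := by
    rw [hfib_def]; exact transform_sing_over_subsingleton hπ hRg hξS hDξ
  have hfib_fin : fib.Finite := hfib_sub.finite
  refine ⟨hunion ▸ hoff_fin.union hfib_fin, ?_⟩
  have h1 : off.ncard ≤ (E.sing \ {ξ}).ncard :=
    Set.ncard_le_ncard_of_injOn π.base hoff_maps hoff_inj (hfin.subset fun _ hx => hx.1)
  have h2 : fib.ncard ≤ 1 := (Set.ncard_le_one hfib_fin).mpr fun a ha b hb => hfib_sub ha hb
  have h3 : (E.sing \ {ξ}).ncard = E.sing.ncard - 1 := Set.ncard_sdiff_singleton_of_mem hξS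
  have h4 : 0 < E.sing.ncard := (Set.ncard_pos hfin).mpr ⟨ξ, hξS⟩
  calc (E.transform π D).sing.ncard = (off ∪ fib).ncard := by rw [hunion]
    _ ≤ off.ncard + fib.ncard := Set.ncard_union_le _ _
    _ ≤ E.sing.ncard := by omega

/-- **The total cusp index drops by at least `b`, résumé-free**: `Σ(E′) + b ≤ Σ(E)` (`Multiset.sum` of
`cuspMultiset`). [folklore] -/
theorem transform_sum_cuspMultiset_add_le (hπ : IsBlowup π (vanishingIdeal D)) (hRg : Regime.cuspCurve A E)
    (hDirr : IsIrreducible (D : Set A.Z)) (hDS : (D : Set A.Z) ⊆ E.sing) :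
    (cuspMultiset (E.transform π D)).sum + E.b ≤ (cuspMultiset E).sum := by
  classical
  obtain ⟨ξ, hξS, hξcl, hDξ⟩ := exists_eq_singleton_of_subset_sing hRg.2.2.1 hDirr hDS
  have hfin : E.sing.Finite := hRg.2.1
  have hfin' : (E.transform π D).sing.Finite := (transform_sing_finite_and_ncard_le hπ hRg hDirr hDS).1
  obtain ⟨S, hS⟩ : ∃ S : Finset A.Z, S = hfin.toFinset := ⟨_, rfl⟩
  obtain ⟨S', hS'⟩ : ∃ S' : Finset A'.Z, S' = hfin'.toFinset := ⟨_, rfl⟩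
  have hmemS : ∀ z, z ∈ S ↔ z ∈ E.sing := fun z => by rw [hS, Set.Finite.mem_toFinset]
  have hmemS' : ∀ z, z ∈ S' ↔ z ∈ (E.transform π D).sing := fun z => by rw [hS', Set.Finite.mem_toFinset]
  set Soff := S'.filter (fun x' => π.base x' ≠ ξ) with hSoff
  set Sfib := S'.filter (fun x' => ¬ π.base x' ≠ ξ) with hSfib
  set T := Soff.image π.base with hT
  have hoff : ∀ x' ∈ Soff, π.base x' ∈ E.sing ∧
      cuspIndexAt (E.transform π D) x' = cuspIndexAt E (π.base x') :=
    fun x' hx' => transform_mem_sing_and_cuspIndexAt_eq_of_ne hπ hDξ ((hmemS' x').mp (Finset.mem_filter.mp hx').1)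
      (Finset.mem_filter.mp hx').2
  have hinj : ∀ x₁ ∈ Soff, ∀ x₂ ∈ Soff, π.base x₁ = π.base x₂ → x₁ = x₂ := by
    intro x₁ hx₁ x₂ hx₂ h
    refine MohWindow.injOn_preimage_compl hπ ?_ ?_ h
    · show π.base x₁ ∈ (D : Set A.Z)ᶜ
      rw [hDξ]; exact (Finset.mem_filter.mp hx₁).2
    · show π.base x₂ ∈ (D : Set A.Z)ᶜ
      rw [hDξ]; exact (Finset.mem_filter.mp hx₂).2
  have hTS : T ⊆ S.erase ξ := by
    intro z hz
    obtain ⟨x', hx', rfl⟩ := Finset.mem_image.mp hz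
    exact Finset.mem_erase.mpr ⟨(Finset.mem_filter.mp hx').2, (hmemS _).mpr (hoff x' hx').1⟩
  have hξmem : ξ ∈ S := (hmemS ξ).mpr hξS
  obtain ⟨hnd, hshape⟩ := Cusp.cuspIndex_spec (hRg.2.2.2 ξ hξS)
  have hbd : E.b < cuspIndexAt E ξ := Cusp.lt_of_cuspShape_of_le_pow hshape hnd (stalkIdeal_le_pow_of_mem_sing hξS)
  have hM' : (cuspMultiset (E.transform π D)).sum =
      ∑ x' ∈ Soff, cuspIndexAt (E.transform π D) x' + ∑ x' ∈ Sfib, cuspIndexAt (E.transform π D) x' := by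
    rw [cuspMultiset_eq _ hfin', ← hS', ← Finset.sum_eq_multiset_sum, hSoff, hSfib,
      Finset.sum_filter_add_sum_filter_not]
  have hM : (cuspMultiset E).sum = ∑ z ∈ S.erase ξ, cuspIndexAt E z + cuspIndexAt E ξ := by
    rw [cuspMultiset_eq _ hfin, ← hS, ← Finset.sum_eq_multiset_sum, Finset.sum_erase_add S _ hξmem]
  have hX : ∑ x' ∈ Soff, cuspIndexAt (E.transform π D) x' = ∑ z ∈ T, cuspIndexAt E z := by
    rw [hT, Finset.sum_image hinj]
    exact Finset.sum_congr rfl fun x' hx' => (hoff x' hx').2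
  have hXle : ∑ z ∈ T, cuspIndexAt E z ≤ ∑ z ∈ S.erase ξ, cuspIndexAt E z :=
    Finset.sum_le_sum_of_subset hTS
  have hfib : ∑ x' ∈ Sfib, cuspIndexAt (E.transform π D) x' + E.b ≤ cuspIndexAt E ξ := by
    rcases Sfib.eq_empty_or_nonempty with h0 | ⟨x₀, hx₀⟩
    · rw [h0, Finset.sum_empty, zero_add]
      exact hbd.le
    · have hsub : ∀ x' ∈ Sfib, x' = x₀ := fun x' hx' => by
        have hx'm := Finset.mem_filter.mp hx'
        have hx₀m := Finset.mem_filter.mp hx₀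
        exact transform_sing_over_subsingleton hπ hRg hξS hDξ ⟨(hmemS' _).mp hx'm.1, not_not.mp hx'm.2⟩
          ⟨(hmemS' _).mp hx₀m.1, not_not.mp hx₀m.2⟩
      have hSfib1 : Sfib = {x₀} := Finset.eq_singleton_iff_unique_mem.mpr ⟨hx₀, hsub⟩
      rw [hSfib1, Finset.sum_singleton]
      have hx₀m := Finset.mem_filter.mp hx₀
      exact (transform_cuspAt_and_cuspIndexAt_le_of_over hπ hRg hξS hDξ ((hmemS' _).mp hx₀m.1)
        (not_not.mp hx₀m.2)).2
  rw [hM', hM, hX]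
  omega

/-! ## The staircase regime propagates under permissible point blow-ups -/

/-- [OURS · L1 W4.6 rung (iii); NOT a statement of the manuscript] **The staircase regime is stable under every
§2.1-permissible blow-up**, résumé-free: for a staircase state `(A, E)`, an irreducible closed `D ⊆ Sing(E)` and the
blow-up `π : A′.Z → A.Z` along its reduced ideal over the same base field, `(A′, E.transform π D)` is a staircase state.
[folklore] -/
theorem transform_cuspCurve (hπ : IsBlowup π (vanishingIdeal D)) (hhom : A'.hom = π ≫ A.hom)
    (hRg : Regime.cuspCurve A E) (hDirr : IsIrreducible (D : Set A.Z)) (hDS : (D : Set A.Z) ⊆ E.sing) :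
    Regime.cuspCurve A' (E.transform π D) := by
  classical
  obtain ⟨ξ, hξS, hξcl, hDξ⟩ := exists_eq_singleton_of_subset_sing hRg.2.2.1 hDirr hDS
  have hfin' := (transform_sing_finite_and_ncard_le hπ hRg hDirr hDS).1
  have hRg' := hRg
  obtain ⟨hb, -, hcl, hcusp⟩ := hRg
  refine ⟨hb, hfin', fun x' hx' => ?_, fun x' hx' => ?_⟩
  · by_cases hπx : π.base x' = ξ
    · exact transform_isClosed_singleton_of_over hπ hhom hRg' hξS hDξ hx' hπx
    · exact transform_isClosed_singleton_of_ne hπ hDξ hπx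
        (hcl (transform_mem_sing_and_cuspIndexAt_eq_of_ne hπ hDξ hx' hπx).1)
  · by_cases hπx : π.base x' = ξ
    · exact (transform_cuspAt_and_cuspIndexAt_le_of_over hπ hRg' hξS hDξ hx' hπx).1
    · exact (transform_germ_of_ne hπ hDξ hπx).1
        (hcusp _ (transform_mem_sing_and_cuspIndexAt_eq_of_ne hπ hDξ hx' hπx).1)

end PermissibleStep

end Cusp

end CampaignW46

end Summit.ResolutionOfSingularities.ResolutionOfSingularities.Theorems

end
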